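import Literature.MathematicalPhysics.QuantumManyBody.BoseGasThermodynamicLimitRuelle
import Mathlib.MeasureTheory.Integral.IntervalIntegral.FundThmCalculus
import Mathlib.MeasureTheory.Integral.Marginal

/-!
# Hard cores at finite energy: vanishing at contact and few nearly-touching pairs

Topic `Literature/MathematicalPhysics/QuantumManyBody`, over the carriers of
`BoseEinsteinCondensation.lean` (`Config N = (ℝ³)^N`, `kineticDensity`, `interaction`) and
`BoseGasThermodynamicLimitRuelle.lean` (`rawEnergy v ψ = ∫ (|∇ψ|² + ∑_{i<j} v(|xᵢ-xⱼ|)|ψ|²)`,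
`hardCorePotential`, `interaction_eq_top_of_apply_eq_top`, `fderiv_eq_zero_of_mem_closure`).

For a pair potential with a **hard core of diameter `a`** (`v(r) = +∞` for `r < a`, the hard-sphere
gas of LSSY 2005, Ch. 2, paragraph after (2.1): "An important special case is the hard core
potential `v(r) = ∞` if `r < a` and `v(r) = 0` otherwise") a `C¹` wave function `ψ` of finite
energy must vanish wherever two particles are at distance `≤ a` (`eq_zero_of_dist_le`), together
with its gradient (`fderiv_eq_zero_of_dist_le`). The main result of this file is the quantitative
companion used in the free-volume ("remove the tight particles and compress") argument for the
blow-up of the energy per particle at the close-packing density (sequel file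
`BoseGasHardCoreCriticalDensity.lean`):

* `sum_lintegral_shellPair_le` — **few nearly-touching pairs**: for `0 < δ ≤ a/20`,
  `∑_i ∑_{j ≠ i} ∫ 1{a < |xᵢ - xⱼ| < a + δ} |ψ|² ≤ 576 δ² ∫ |∇ψ|²`.

Proof (elementary, self-contained): on every line parallel to a coordinate axis `e_{i,k}` the set
where `a < |xᵢ - xⱼ| < a + δ` and the axis is transversal enough to the contact sphere
(`|xᵢ - xⱼ|² - (x_{i,k} - x_{j,k})² ≤ 3a²/4`, one sign of `x_{i,k} - x_{j,k}`) is an interval of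
length `≤ 3δ` at whose contact end `ψ` vanishes, so the one-dimensional Poincaré inequality
`∫_I |f|² ≤ |I|² ∫_I |f'|²` (`poincare_Ioo_of_zero`, from the fundamental theorem of calculus and
Cauchy–Schwarz) applies (`lintegral_line_shellPairCone_le`); Fubini over the lines is organised
through Mathlib's marginal integrals (`lintegral_le_of_forall_line`); the six coordinate cones cover
the shell (`exists_mem_shellPairCone`); and since the gradient vanishes unless all particles are
pairwise `≥ a` apart, each particle has at most `64` partners within `3a/2` (disjoint balls of radius
`a/2` in a ball of radius `2a`, `card_filter_dist_lt_le`), which sums the per-pair bound into the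
kinetic energy. The constants are not optimised.

References: E. H. Lieb, R. Seiringer, J. P. Solovej, J. Yngvason, *The Mathematics of the Bose Gas
and its Condensation* (2005) [LSSY2005], Ch. 2 (hard-core potential). The estimates themselves are
standard Sobolev-space facts (one-dimensional Poincaré inequality on an interval with a zero,
Fubini) and are tagged folklore.

Deliberately NOT here: soft potentials; optimal constants; the thermodynamic consequences
(sequel file `BoseGasHardCoreCriticalDensity.lean`).
-/

noncomputable section

open MeasureTheory Filter Topology Set Function
open scoped ENNReal NNReal Interval

namespace Literature.MathematicalPhysics.QuantumManyBody.BoseGas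

/-! ### One-dimensional Poincaré inequality -/

/-- Cauchy–Schwarz: `(∫ φ)² ≤ μ(univ) · ∫ φ²`. [folklore] -/
theorem lintegral_sq_le_measure_univ_mul {α : Type*} [MeasurableSpace α] (μ : Measure α)
    {φ : α → ℝ≥0∞} (hφ : AEMeasurable φ μ) :
    (∫⁻ a, φ a ∂μ) ^ 2 ≤ μ univ * ∫⁻ a, φ a ^ 2 ∂μ := by
  have h := ENNReal.lintegral_mul_le_Lp_mul_Lq μ Real.HolderConjugate.two_two hφ
    (aemeasurable_const (b := (1 : ℝ≥0∞)))
  have h1 : (φ * fun _ => (1 : ℝ≥0∞)) = φ := by ext a; simp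
  rw [h1] at h
  simp only [ENNReal.one_rpow, lintegral_const, one_mul] at h
  have h2 := pow_le_pow_left' h 2
  rw [mul_pow, ← ENNReal.rpow_natCast ((∫⁻ a, φ a ^ (2:ℝ) ∂μ) ^ (1 / (2:ℝ))),
    ← ENNReal.rpow_natCast (μ univ ^ (1 / (2:ℝ))), ← ENNReal.rpow_mul, ← ENNReal.rpow_mul] at h2
  norm_num at h2
  rw [mul_comm] at h2
  convert h2 using 3 with a

/-- Cauchy–Schwarz on a set: `(∫_s φ)² ≤ μ(s) · ∫_s φ²`. [folklore] -/
theorem setLIntegral_sq_le_measure_mul {α : Type*} [MeasurableSpace α] (μ : Measure α)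
    {φ : α → ℝ≥0∞} (hφ : AEMeasurable φ μ) (s : Set α) :
    (∫⁻ a in s, φ a ∂μ) ^ 2 ≤ μ s * ∫⁻ a in s, φ a ^ 2 ∂μ := by
  have := lintegral_sq_le_measure_univ_mul (μ.restrict s) hφ.restrict
  rwa [Measure.restrict_apply_univ] at this

/-- **One-dimensional Poincaré inequality with a zero**: if `f : ℝ → ℂ` has the continuous
derivative `f'` and vanishes at some point of `[t₀, t₁]`, then
`∫_{(t₀,t₁)} |f|² ≤ (t₁ - t₀)² ∫_{(t₀,t₁)} |f'|²`. [folklore] -/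
theorem poincare_Ioo_of_zero {f f' : ℝ → ℂ} {t₀ t₁ tz : ℝ} (htz : tz ∈ Icc t₀ t₁)
    (hzero : f tz = 0) (hderiv : ∀ t, HasDerivAt f (f' t) t) (hcont : Continuous f') :
    ∫⁻ t in Ioo t₀ t₁, (‖f t‖₊ : ℝ≥0∞) ^ 2 ≤
      ENNReal.ofReal ((t₁ - t₀) ^ 2) * ∫⁻ t in Ioo t₀ t₁, (‖f' t‖₊ : ℝ≥0∞) ^ 2 := by
  have h01 : t₀ ≤ t₁ := htz.1.trans htz.2
  set J : ℝ≥0∞ := ∫⁻ t in Ioo t₀ t₁, (‖f' t‖₊ : ℝ≥0∞) with hJ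
  set K : ℝ≥0∞ := ∫⁻ t in Ioo t₀ t₁, (‖f' t‖₊ : ℝ≥0∞) ^ 2 with hK
  have hpt : ∀ t ∈ Icc t₀ t₁, (‖f t‖₊ : ℝ≥0∞) ≤ J := by
    intro t ht
    have hftc : ∫ s in tz..t, f' s = f t - f tz :=
      intervalIntegral.integral_eq_sub_of_hasDerivAt (fun s _ => hderiv s)
        (hcont.intervalIntegrable _ _)
    rw [hzero, sub_zero] at hftc
    have hn : ‖f t‖ ≤ |∫ s in tz..t, ‖f' s‖| := by
      rw [← hftc]; exact intervalIntegral.norm_integral_le_abs_integral_norm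
    have hsub : Ι tz t ⊆ Ι t₀ t₁ := by
      refine Set.uIoc_subset_uIoc_of_uIcc_subset_uIcc (Set.uIcc_subset_uIcc ?_ ?_)
      · rw [Set.uIcc_of_le h01]; exact htz
      · rw [Set.uIcc_of_le h01]; exact ht
    have hmono : |∫ s in tz..t, ‖f' s‖| ≤ |∫ s in t₀..t₁, ‖f' s‖| :=
      intervalIntegral.abs_integral_mono_interval hsub
        (Filter.Eventually.of_forall fun _ => norm_nonneg _)
        (hcont.norm.intervalIntegrable _ _)
    have hint : |∫ s in t₀..t₁, ‖f' s‖| = ∫ s in Ioc t₀ t₁, ‖f' s‖ := by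
      rw [intervalIntegral.integral_of_le h01,
        abs_of_nonneg (setIntegral_nonneg measurableSet_Ioc fun _ _ => norm_nonneg _)]
    have hreal : ‖f t‖ ≤ ∫ s in Ioc t₀ t₁, ‖f' s‖ := hn.trans (hint ▸ hmono)
    have hlin : ENNReal.ofReal (∫ s in Ioc t₀ t₁, ‖f' s‖) =
        ∫⁻ s in Ioc t₀ t₁, (‖f' s‖₊ : ℝ≥0∞) := by
      rw [ofReal_integral_eq_lintegral_ofReal
        ((hcont.norm.integrableOn_Icc).mono_set Ioc_subset_Icc_self)
        (Filter.Eventually.of_forall fun _ => norm_nonneg _)]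
      simp_rw [ofReal_norm]
      rfl
    calc (‖f t‖₊ : ℝ≥0∞) = ENNReal.ofReal ‖f t‖ := (ofReal_norm (f t)).symm
      _ ≤ ENNReal.ofReal (∫ s in Ioc t₀ t₁, ‖f' s‖) := ENNReal.ofReal_le_ofReal hreal
      _ = ∫⁻ s in Ioc t₀ t₁, (‖f' s‖₊ : ℝ≥0∞) := hlin
      _ = J := (setLIntegral_congr Ioo_ae_eq_Ioc).symm
  have hCS : J ^ 2 ≤ ENNReal.ofReal (t₁ - t₀) * K := by
    have := setLIntegral_sq_le_measure_mul volume (φ := fun t => (‖f' t‖₊ : ℝ≥0∞))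
      hcont.measurable.nnnorm.coe_nnreal_ennreal.aemeasurable (Ioo t₀ t₁)
    simpa [Real.volume_Ioo] using this
  calc ∫⁻ t in Ioo t₀ t₁, (‖f t‖₊ : ℝ≥0∞) ^ 2 ≤ ∫⁻ _ in Ioo t₀ t₁, J ^ 2 := by
        refine setLIntegral_mono measurable_const fun t ht => ?_
        exact pow_le_pow_left' (hpt t (Ioo_subset_Icc_self ht)) 2
    _ = ENNReal.ofReal (t₁ - t₀) * J ^ 2 := by rw [setLIntegral_const, Real.volume_Ioo, mul_comm]
    _ ≤ ENNReal.ofReal (t₁ - t₀) * (ENNReal.ofReal (t₁ - t₀) * K) := mul_le_mul_right hCS _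
    _ = ENNReal.ofReal ((t₁ - t₀) ^ 2) * K := by
        rw [← mul_assoc, ← ENNReal.ofReal_mul (sub_nonneg.2 h01), sq]


/-! ### Coordinate lines in configuration space -/

section Lines

variable {N : ℕ}

/-- The point of configuration space obtained from `X` by giving particle `i` the coordinates
`y` with its `k`-th coordinate replaced by `t` (the coordinate line through `X` along `e_{i,k}`).
[folklore] -/
def linePoint (X : Config N) (i : Fin N) (y : Fin 3 → ℝ) (k : Fin 3) (t : ℝ) : Config N :=
  update X i (WithLp.toLp 2 (update y k t))

/-- On the coordinate line, particle `i` sits at `(y with y_k := t)`. [folklore] -/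
theorem linePoint_apply_self (X : Config N) (i : Fin N) (y : Fin 3 → ℝ) (k : Fin 3) (t : ℝ) :
    linePoint X i y k t i = WithLp.toLp 2 (update y k t) := by
  simp [linePoint]

/-- On the coordinate line, the other particles do not move. [folklore] -/
theorem linePoint_apply_of_ne (X : Config N) {i j : Fin N} (hj : j ≠ i) (y : Fin 3 → ℝ)
    (k : Fin 3) (t : ℝ) : linePoint X i y k t j = X j := by
  simp [linePoint, hj]

/-- The coordinate line is affine in `t` with direction `e_{i,k}`. [folklore] -/
theorem linePoint_eq_add_smul (X : Config N) (i : Fin N) (y : Fin 3 → ℝ) (k : Fin 3) (t : ℝ) :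
    linePoint X i y k t = linePoint X i y k 0 + t • unitVec i k := by
  funext j
  rcases eq_or_ne j i with rfl | hj
  · simp only [linePoint, update_self, Pi.add_apply, Pi.smul_apply, unitVec, Pi.single_eq_same]
    ext k'
    rcases eq_or_ne k' k with rfl | hk
    · simp
    · simp [hk]
  · simp [linePoint, hj, unitVec]

/-- **Reduction to coordinate lines.** An inequality between integrals over configuration space
holds as soon as it holds on (almost) every line parallel to a coordinate axis `e_{i,k}`
(Fubini, singling out the real coordinate `x_{i,k}`). [folklore] -/
theorem lintegral_le_of_forall_line (i : Fin N) (k : Fin 3) {F G : Config N → ℝ≥0∞}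
    (hF : Measurable F) (hG : Measurable G)
    (h : ∀ (X : Config N) (y : Fin 3 → ℝ),
      ∫⁻ t, F (linePoint X i y k t) ≤ ∫⁻ t, G (linePoint X i y k t)) :
    ∫⁻ X, F X ≤ ∫⁻ X, G X := by
  have hvol : (volume : Measure (Config N)) = Measure.pi fun _ => volume := rfl
  rw [hvol]
  refine lintegral_le_of_lmarginal_le {i} hF hG ?_
  rw [lmarginal_singleton, lmarginal_singleton]
  intro X
  have hFu : Measurable fun x : Space => F (update X i x) := hF.comp (measurable_update X)
  have hGu : Measurable fun x : Space => G (update X i x) := hG.comp (measurable_update X)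
  have e := PiLp.volume_preserving_toLp (Fin 3)
  change ∫⁻ x : Space, F (update X i x) ≤ ∫⁻ x : Space, G (update X i x)
  rw [← e.lintegral_comp hFu, ← e.lintegral_comp hGu]
  have hvol3 : (volume : Measure (Fin 3 → ℝ)) = Measure.pi fun _ => volume := rfl
  rw [hvol3]
  refine lintegral_le_of_lmarginal_le {k} (hFu.comp e.measurable) (hGu.comp e.measurable) ?_
  rw [lmarginal_singleton, lmarginal_singleton]
  intro y
  exact h X y

/-- Squared distance along a coordinate line to another particle:
`|x_i(t) - x_j|² = (t - x_{j,k})² + ∑_{k' ≠ k} (y_{k'} - x_{j,k'})²`. [folklore] -/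
theorem dist_linePoint_sq (X : Config N) {i j : Fin N} (hj : j ≠ i) (y : Fin 3 → ℝ) (k : Fin 3)
    (t : ℝ) :
    dist (linePoint X i y k t i) (linePoint X i y k t j) ^ 2 =
      (t - X j k) ^ 2 + ∑ k' ∈ Finset.univ.erase k, (y k' - X j k') ^ 2 := by
  rw [linePoint_apply_self, linePoint_apply_of_ne X hj, EuclideanSpace.dist_eq,
    Real.sq_sqrt (Finset.sum_nonneg fun _ _ => sq_nonneg _),
    ← Finset.add_sum_erase _ _ (Finset.mem_univ k)]
  congr 1
  · simp [Real.dist_eq, sq_abs]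
  · refine Finset.sum_congr rfl fun k' hk' => ?_
    rw [Finset.mem_erase] at hk'
    simp [Real.dist_eq, sq_abs, hk'.1]

/-- The `k`-th coordinate difference along the line. [folklore] -/
theorem linePoint_sub_apply (X : Config N) {i j : Fin N} (hj : j ≠ i) (y : Fin 3 → ℝ) (k : Fin 3)
    (t : ℝ) : linePoint X i y k t i k - linePoint X i y k t j k = t - X j k := by
  rw [linePoint_apply_self, linePoint_apply_of_ne X hj]
  simp


end Lines

/-! ### The shell of nearly touching pairs and its covering by coordinate cones -/

section Shell

variable {N : ℕ} {a δ : ℝ}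

/-- Pairs within `δ` of contact: `a < |x_i - x_j| < a + δ`. [folklore] -/
def shellPair (a δ : ℝ) (i j : Fin N) : Set (Config N) :=
  {X | a < dist (X i) (X j) ∧ dist (X i) (X j) < a + δ}

/-- The part of the shell on the side `σ (x_{i,k} - x_{j,k}) > 0` (`σ = ±1`). [folklore] -/
def shellPairSign (a δ : ℝ) (i j : Fin N) (k : Fin 3) (σ : ℝ) : Set (Config N) :=
  {X | X ∈ shellPair a δ i j ∧ 0 < σ * (X i k - X j k)}

/-- The part of the shell on the side `σ (x_{i,k} - x_{j,k}) > 0` and transversal to the axis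
`k`: `|x_i - x_j|² - (x_{i,k} - x_{j,k})² ≤ 3a²/4`. [folklore] -/
def shellPairCone (a δ : ℝ) (i j : Fin N) (k : Fin 3) (σ : ℝ) : Set (Config N) :=
  {X | X ∈ shellPairSign a δ i j k σ ∧ dist (X i) (X j) ^ 2 - (X i k - X j k) ^ 2 ≤ 3 * a ^ 2 / 4}

/-- `X ↦ |x_i - x_j|` is measurable. [folklore] -/
theorem measurable_dist_pair (i j : Fin N) : Measurable fun X : Config N => dist (X i) (X j) :=
  ((continuous_apply i).dist (continuous_apply j)).measurable

/-- `X ↦ x_{i,k} - x_{j,k}` is continuous. [folklore] -/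
theorem continuous_coord_sub (i j : Fin N) (k : Fin 3) :
    Continuous fun X : Config N => X i k - X j k := by
  fun_prop

/-- The shell is measurable. [folklore] -/
theorem measurableSet_shellPair (a δ : ℝ) (i j : Fin N) :
    MeasurableSet (shellPair a δ i j : Set (Config N)) :=
  (measurableSet_lt measurable_const (measurable_dist_pair i j)).inter
    (measurableSet_lt (measurable_dist_pair i j) measurable_const)

/-- The half-shell is measurable. [folklore] -/
theorem measurableSet_shellPairSign (a δ : ℝ) (i j : Fin N) (k : Fin 3) (σ : ℝ) :
    MeasurableSet (shellPairSign a δ i j k σ : Set (Config N)) :=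
  (measurableSet_shellPair a δ i j).inter
    (measurableSet_lt measurable_const ((continuous_coord_sub i j k).measurable.const_mul σ))

/-- The cone part of the shell is measurable. [folklore] -/
theorem measurableSet_shellPairCone (a δ : ℝ) (i j : Fin N) (k : Fin 3) (σ : ℝ) :
    MeasurableSet (shellPairCone a δ i j k σ : Set (Config N)) :=
  (measurableSet_shellPairSign a δ i j k σ).inter
    (measurableSet_le (((measurable_dist_pair i j).pow_const 2).sub
      ((continuous_coord_sub i j k).measurable.pow_const 2)) measurable_const)

/-- `|x - y|² = ∑ₖ (xₖ - yₖ)²`. [folklore] -/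
theorem dist_sq_eq_sum_coord (x y : Space) : dist x y ^ 2 = ∑ k, (x k - y k) ^ 2 := by
  rw [EuclideanSpace.dist_eq, Real.sq_sqrt (Finset.sum_nonneg fun _ _ => sq_nonneg _)]
  simp [Real.dist_eq, sq_abs]

/-- Some coordinate carries a third of the squared distance. [folklore] -/
theorem exists_dist_sq_le_three_mul_coord_sq (x y : Space) :
    ∃ k : Fin 3, dist x y ^ 2 ≤ 3 * (x k - y k) ^ 2 := by
  obtain ⟨k, -, hk⟩ := Finset.exists_max_image Finset.univ (fun k : Fin 3 => (x k - y k) ^ 2)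
    Finset.univ_nonempty
  refine ⟨k, ?_⟩
  rw [dist_sq_eq_sum_coord]
  calc ∑ k', (x k' - y k') ^ 2 ≤ ∑ _k' : Fin 3, (x k - y k) ^ 2 :=
        Finset.sum_le_sum fun k' _ => hk k' (Finset.mem_univ _)
    _ = 3 * (x k - y k) ^ 2 := by simp

/-- **Covering of the shell by the six coordinate cones** (for `δ ≤ a/20`): a pair in the shell
lies in the cone of its largest coordinate difference. [folklore] -/
theorem exists_mem_shellPairCone (ha : 0 < a) (hδa : 20 * δ ≤ a) {i j : Fin N} {X : Config N}
    (hX : X ∈ shellPair a δ i j) :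
    ∃ k : Fin 3, ∃ σ : ℝ, (σ = 1 ∨ σ = -1) ∧ X ∈ shellPairCone a δ i j k σ := by
  obtain ⟨k, hk⟩ := exists_dist_sq_le_three_mul_coord_sq (X i) (X j)
  have hd0 : 0 ≤ dist (X i) (X j) := dist_nonneg
  have hd : dist (X i) (X j) ^ 2 < (a + δ) ^ 2 := pow_lt_pow_left₀ hX.2 hd0 two_ne_zero
  have hda : a ^ 2 < dist (X i) (X j) ^ 2 := pow_lt_pow_left₀ hX.1 ha.le two_ne_zero
  have had : (a + δ) ^ 2 ≤ (21 / 20 * a) ^ 2 :=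
    pow_le_pow_left₀ (by linarith [hX.1, hX.2]) (by linarith) 2
  have hne : X i k - X j k ≠ 0 := by
    intro h; rw [h] at hk; nlinarith
  have hcone : dist (X i) (X j) ^ 2 - (X i k - X j k) ^ 2 ≤ 3 * a ^ 2 / 4 := by nlinarith
  rcases lt_or_gt_of_ne hne with hlt | hgt
  · exact ⟨k, -1, Or.inr rfl, ⟨hX, by nlinarith⟩, hcone⟩
  · exact ⟨k, 1, Or.inl rfl, ⟨hX, by nlinarith⟩, hcone⟩

/-- The covering in indicator form: `1_shell ≤ ∑ₖ (1_{cone k,+} + 1_{cone k,-})`. [folklore] -/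
theorem indicator_shellPair_le_sum (ha : 0 < a) (hδa : 20 * δ ≤ a) (i j : Fin N)
    (f : Config N → ℝ≥0∞) (X : Config N) :
    (shellPair a δ i j).indicator f X ≤
      ∑ k : Fin 3, ((shellPairCone a δ i j k 1).indicator f X +
        (shellPairCone a δ i j k (-1)).indicator f X) := by
  by_cases hX : X ∈ shellPair a δ i j
  · obtain ⟨k, σ, hσ, hmem⟩ := exists_mem_shellPairCone ha hδa hX
    rw [indicator_of_mem hX]
    refine le_trans ?_ (Finset.single_le_sum (f := fun k => (shellPairCone a δ i j k 1).indicator f X +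
        (shellPairCone a δ i j k (-1)).indicator f X) (fun _ _ => zero_le) (Finset.mem_univ k))
    rcases hσ with rfl | rfl
    · rw [indicator_of_mem hmem]; exact le_self_add
    · rw [indicator_of_mem hmem]; exact le_add_self
  · rw [indicator_of_notMem hX]; exact zero_le

/-- The two half-shells are disjoint parts of the shell: `1_{sign k,+} + 1_{sign k,-} ≤ 1_shell`.
[folklore] -/
theorem indicator_shellPairSign_add_le (i j : Fin N) (k : Fin 3) (f : Config N → ℝ≥0∞)
    (X : Config N) :
    (shellPairSign a δ i j k 1).indicator f X + (shellPairSign a δ i j k (-1)).indicator f X ≤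
      (shellPair a δ i j).indicator f X := by
  by_cases h1 : X ∈ shellPairSign a δ i j k 1
  · have h2 : X ∉ shellPairSign a δ i j k (-1) := fun h2 => by
      have := h1.2; have := h2.2; nlinarith
    rw [indicator_of_mem h1, indicator_of_notMem h2, add_zero, indicator_of_mem h1.1]
  · rw [indicator_of_notMem h1, zero_add]
    by_cases h2 : X ∈ shellPairSign a δ i j k (-1)
    · rw [indicator_of_mem h2, indicator_of_mem h2.1]
    · rw [indicator_of_notMem h2]; exact zero_le

/-- The fibre geometry of the shell over a coordinate line at squared transversal distance
`ρ2 ≤ 3a²/4`: the entry and exit parameters `s₀ = √(a² - ρ2)`, `s₁ = √((a+δ)² - ρ2)` satisfy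
`a/2 ≤ s₀ ≤ s₁ ≤ s₀ + 3δ`. [folklore] -/
theorem shell_fibre_geometry (ha : 0 < a) (hδ : 0 < δ) (hδa : δ ≤ a) {ρ2 : ℝ}
    (hρa : ρ2 ≤ 3 * a ^ 2 / 4) :
    a / 2 ≤ √(a ^ 2 - ρ2) ∧ √(a ^ 2 - ρ2) ≤ √((a + δ) ^ 2 - ρ2) ∧
      √((a + δ) ^ 2 - ρ2) - √(a ^ 2 - ρ2) ≤ 3 * δ ∧
      √(a ^ 2 - ρ2) ^ 2 = a ^ 2 - ρ2 ∧ √((a + δ) ^ 2 - ρ2) ^ 2 = (a + δ) ^ 2 - ρ2 := by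
  set s₀ := √(a ^ 2 - ρ2)
  set s₁ := √((a + δ) ^ 2 - ρ2)
  have h0 : 0 ≤ a ^ 2 - ρ2 := by nlinarith
  have h1 : 0 ≤ (a + δ) ^ 2 - ρ2 := by nlinarith
  have hs0 : s₀ ^ 2 = a ^ 2 - ρ2 := Real.sq_sqrt h0
  have hs1 : s₁ ^ 2 = (a + δ) ^ 2 - ρ2 := Real.sq_sqrt h1
  have hs0a : a / 2 ≤ s₀ := (Real.le_sqrt' (by positivity)).2 (by nlinarith)
  have hs01 : s₀ ≤ s₁ := Real.sqrt_le_sqrt (by nlinarith)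
  refine ⟨hs0a, hs01, ?_, hs0, hs1⟩
  have hprod : (s₁ - s₀) * (s₁ + s₀) = 2 * a * δ + δ ^ 2 := by
    rw [show (s₁ - s₀) * (s₁ + s₀) = s₁ ^ 2 - s₀ ^ 2 by ring, hs1, hs0]; ring
  have hle : (s₁ - s₀) * a ≤ (s₁ - s₀) * (s₁ + s₀) :=
    mul_le_mul_of_nonneg_left (by linarith) (sub_nonneg.2 hs01)
  nlinarith

end Shell

/-! ### The shell estimate on one coordinate line -/

section Fibre

variable {N : ℕ} {a δ : ℝ}

/-- **The shell estimate on a coordinate line.** For a `C¹` wave function vanishing whenever two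
particles are at distance `≤ a`, on every line parallel to `e_{i,k}` the mass in the cone part of
the shell `a < |x_i - x_j| < a + δ` is at most `9δ²` times the `e_{i,k}`-derivative energy in the
half-shell: the line crosses the cone part in an interval of length `≤ 3δ` at whose contact end the
function vanishes (one-dimensional Poincaré). [folklore] -/
theorem lintegral_line_shellPairCone_le (ha : 0 < a) (hδ : 0 < δ) (hδa : δ ≤ a)
    {ψ : Config N → ℂ} (hψ : ContDiff ℝ 1 ψ)
    (hzero : ∀ X : Config N, ∀ i j : Fin N, i ≠ j → dist (X i) (X j) ≤ a → ψ X = 0)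
    {i j : Fin N} (hij : i ≠ j) (k : Fin 3) {σ : ℝ} (hσ : σ = 1 ∨ σ = -1) (X : Config N)
    (y : Fin 3 → ℝ) :
    ∫⁻ t, (shellPairCone a δ i j k σ).indicator (fun X => (‖ψ X‖₊ : ℝ≥0∞) ^ 2)
        (linePoint X i y k t) ≤
      ENNReal.ofReal (9 * δ ^ 2) *
        ∫⁻ t, (shellPairSign a δ i j k σ).indicator
          (fun X => (‖fderiv ℝ ψ X (unitVec i k)‖₊ : ℝ≥0∞) ^ 2) (linePoint X i y k t) := by
  -- the fibre functions
  set L : ℝ → Config N := linePoint X i y k with hL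
  set φ : ℝ → ℂ := fun t => ψ (L t) with hφ
  set φ' : ℝ → ℂ := fun t => fderiv ℝ ψ (L t) (unitVec i k) with hφ'
  have hLeq : L = fun t => linePoint X i y k 0 + t • unitVec i k :=
    funext fun t => linePoint_eq_add_smul X i y k t
  have hLcont : Continuous L := by rw [hLeq]; fun_prop
  have hderiv : ∀ t, HasDerivAt φ (φ' t) t := by
    intro t
    have hline : HasDerivAt (fun s : ℝ => linePoint X i y k 0 + s • unitVec i k)
        (unitVec i k) t := by
      simpa using ((hasDerivAt_id t).smul_const (unitVec i k)).const_add (linePoint X i y k 0)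
    have hψd : HasFDerivAt ψ (fderiv ℝ ψ (L t)) (linePoint X i y k 0 + t • unitVec i k) := by
      rw [← linePoint_eq_add_smul]; exact (hψ.differentiable one_ne_zero _).hasFDerivAt
    have hcomp := hψd.comp_hasDerivAt t hline
    have hfun : (ψ ∘ fun s : ℝ => linePoint X i y k 0 + s • unitVec i k) = φ := by
      funext s; simp [φ, L, ← linePoint_eq_add_smul]
    rwa [hfun] at hcomp
  have hcont' : Continuous φ' :=
    ((hψ.continuous_fderiv one_ne_zero).comp hLcont).clm_apply continuous_const
  -- fibre coordinates
  have hji : j ≠ i := fun h => hij h.symm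
  set c : ℝ := X j k with hc
  set ρ2 : ℝ := ∑ k' ∈ Finset.univ.erase k, (y k' - X j k') ^ 2 with hρ2
  have hdist : ∀ t, dist (L t i) (L t j) ^ 2 = (t - c) ^ 2 + ρ2 := fun t =>
    dist_linePoint_sq X hji y k t
  have hsub : ∀ t, L t i k - L t j k = t - c := fun t => linePoint_sub_apply X hji y k t
  by_cases hρa : ρ2 ≤ 3 * a ^ 2 / 4
  swap
  · -- the line misses the cone part
    have hempty : ∀ t, L t ∉ shellPairCone a δ i j k σ := by
      intro t ht
      have h2 := ht.2
      rw [hdist, hsub] at h2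
      exact hρa (by linarith)
    simp [indicator_of_notMem (hempty _)]
  obtain ⟨hs0a, hs01, hdiffle, hs0sq, hs1sq⟩ := shell_fibre_geometry ha hδ hδa hρa
  set s₀ := √(a ^ 2 - ρ2) with hs₀
  set s₁ := √((a + δ) ^ 2 - ρ2) with hs₁
  -- contact parameter ⇒ zero of `φ`
  have hcontact : ∀ t, (t - c) ^ 2 = s₀ ^ 2 → φ t = 0 := by
    intro t ht
    apply hzero _ i j hij
    have h := hdist t
    rw [ht, hs0sq, sub_add_cancel] at h
    exact ((pow_left_inj₀ dist_nonneg ha.le two_ne_zero).1 h).le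
  -- membership in the cone part / half-shell along the line, in terms of `u = t - c`
  have hmem_cone : ∀ t, L t ∈ shellPairCone a δ i j k σ →
      a ^ 2 < (t - c) ^ 2 + ρ2 ∧ (t - c) ^ 2 + ρ2 < (a + δ) ^ 2 ∧ 0 < σ * (t - c) := by
    intro t ht
    obtain ⟨⟨⟨h1, h2⟩, h3⟩, -⟩ := ht
    rw [hsub] at h3
    refine ⟨?_, ?_, h3⟩
    · rw [← hdist]; exact pow_lt_pow_left₀ h1 ha.le two_ne_zero
    · rw [← hdist]; exact pow_lt_pow_left₀ h2 dist_nonneg two_ne_zero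
  have hmem_sign : ∀ t, a ^ 2 < (t - c) ^ 2 + ρ2 → (t - c) ^ 2 + ρ2 < (a + δ) ^ 2 →
      0 < σ * (t - c) → L t ∈ shellPairSign a δ i j k σ := by
    intro t h1 h2 h3
    refine ⟨⟨?_, ?_⟩, by rwa [hsub]⟩
    · exact lt_of_pow_lt_pow_left₀ 2 dist_nonneg (by rw [hdist]; exact h1)
    · exact lt_of_pow_lt_pow_left₀ 2 (by linarith) (by rw [hdist]; exact h2)
  -- the interval `(lo, hi)` containing the cone fibre, contained in the half-shell fibre
  obtain ⟨lo, hi, tz, hlohi, htz, hzero', hcone_sub, hsub_sign⟩ :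
      ∃ lo hi tz : ℝ, hi - lo ≤ 3 * δ ∧ tz ∈ Icc lo hi ∧ φ tz = 0 ∧
        (∀ t, L t ∈ shellPairCone a δ i j k σ → t ∈ Ioo lo hi) ∧
        (∀ t ∈ Ioo lo hi, L t ∈ shellPairSign a δ i j k σ) := by
    rcases hσ with rfl | rfl
    · refine ⟨c + s₀, c + s₁, c + s₀, by linarith, ⟨le_rfl, by linarith⟩,
        hcontact _ (by ring), ?_, ?_⟩
      · intro t ht
        obtain ⟨h1, h2, h3⟩ := hmem_cone t ht
        rw [one_mul] at h3
        have hlt1 : s₀ < t - c := lt_of_pow_lt_pow_left₀ 2 h3.le (by linarith)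
        have hlt2 : t - c < s₁ := lt_of_pow_lt_pow_left₀ 2 (by linarith) (by linarith)
        exact ⟨by linarith, by linarith⟩
      · intro t ht
        have hu1 : s₀ < t - c := by linarith [ht.1]
        have hu2 : t - c < s₁ := by linarith [ht.2]
        have hu : 0 < t - c := by linarith
        have hsq1 : s₀ ^ 2 < (t - c) ^ 2 := pow_lt_pow_left₀ hu1 (by linarith) two_ne_zero
        have hsq2 : (t - c) ^ 2 < s₁ ^ 2 := pow_lt_pow_left₀ hu2 hu.le two_ne_zero
        exact hmem_sign t (by linarith) (by linarith) (by linarith)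
    · refine ⟨c - s₁, c - s₀, c - s₀, by linarith, ⟨by linarith, le_rfl⟩,
        hcontact _ (by ring), ?_, ?_⟩
      · intro t ht
        obtain ⟨h1, h2, h3⟩ := hmem_cone t ht
        have h3' : 0 < c - t := by linarith
        have hlt1 : s₀ < c - t :=
          lt_of_pow_lt_pow_left₀ 2 h3'.le (by nlinarith)
        have hlt2 : c - t < s₁ := lt_of_pow_lt_pow_left₀ 2 (by linarith) (by nlinarith)
        exact ⟨by linarith, by linarith⟩
      · intro t ht
        have hu1 : s₀ < c - t := by linarith [ht.2]
        have hu2 : c - t < s₁ := by linarith [ht.1]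
        have hu : 0 < c - t := by linarith
        have hsq1 : s₀ ^ 2 < (c - t) ^ 2 := pow_lt_pow_left₀ hu1 (by linarith) two_ne_zero
        have hsq2 : (c - t) ^ 2 < s₁ ^ 2 := pow_lt_pow_left₀ hu2 hu.le two_ne_zero
        have hsq : (t - c) ^ 2 = (c - t) ^ 2 := by ring
        exact hmem_sign t (by linarith) (by linarith) (by linarith)
  -- conclusion: Poincaré on `(lo, hi)`
  calc ∫⁻ t, (shellPairCone a δ i j k σ).indicator (fun X => (‖ψ X‖₊ : ℝ≥0∞) ^ 2) (L t)
      ≤ ∫⁻ t, (Ioo lo hi).indicator (fun t => (‖φ t‖₊ : ℝ≥0∞) ^ 2) t := by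
        refine lintegral_mono fun t => ?_
        by_cases ht : L t ∈ shellPairCone a δ i j k σ
        · rw [indicator_of_mem ht, indicator_of_mem (hcone_sub t ht)]
        · rw [indicator_of_notMem ht]; exact zero_le
    _ = ∫⁻ t in Ioo lo hi, (‖φ t‖₊ : ℝ≥0∞) ^ 2 := lintegral_indicator measurableSet_Ioo _
    _ ≤ ENNReal.ofReal ((hi - lo) ^ 2) * ∫⁻ t in Ioo lo hi, (‖φ' t‖₊ : ℝ≥0∞) ^ 2 :=
        poincare_Ioo_of_zero htz hzero' hderiv hcont'
    _ ≤ ENNReal.ofReal (9 * δ ^ 2) * ∫⁻ t, (shellPairSign a δ i j k σ).indicator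
          (fun X => (‖fderiv ℝ ψ X (unitVec i k)‖₊ : ℝ≥0∞) ^ 2) (L t) := by
        have hlen : 0 ≤ hi - lo := by linarith [htz.1, htz.2]
        refine mul_le_mul' (ENNReal.ofReal_le_ofReal (by nlinarith)) ?_
        rw [← lintegral_indicator measurableSet_Ioo]
        refine lintegral_mono fun t => ?_
        by_cases ht : t ∈ Ioo lo hi
        · rw [indicator_of_mem ht, indicator_of_mem (hsub_sign t ht)]
        · rw [indicator_of_notMem ht]; exact zero_le

end Fibre

/-! ### Hard cores: the wave function vanishes at contact -/

section Core

variable {N : ℕ} {a : ℝ} {v : ℝ → ℝ≥0∞}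

/-- The open set of configurations with a pair of particles at distance `< a` (overlapping hard
cores). [folklore] -/
def coreSet (a : ℝ) (N : ℕ) : Set (Config N) :=
  {X | ∃ i j : Fin N, i ≠ j ∧ dist (X i) (X j) < a}

/-- The core set is open. [folklore] -/
theorem isOpen_coreSet : IsOpen (coreSet a N) := by
  have : coreSet a N = ⋃ i : Fin N, ⋃ j : Fin N, {X : Config N | i ≠ j ∧ dist (X i) (X j) < a} := by
    ext X; simp [coreSet]
  rw [this]
  refine isOpen_iUnion fun i => isOpen_iUnion fun j => ?_
  by_cases hij : i = j
  · simp [hij]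
  · simp only [ne_eq, hij, not_false_eq_true, true_and]
    exact isOpen_lt ((continuous_apply i).dist (continuous_apply j)) continuous_const

/-- A configuration with a pair at distance `≤ a` is a limit of configurations with overlapping
cores (move one of the two particles towards the other). [folklore] -/
theorem mem_closure_coreSet (ha : 0 < a) {X : Config N} {i j : Fin N} (hij : i ≠ j)
    (h : dist (X i) (X j) ≤ a) : X ∈ closure (coreSet a N) := by
  set P : ℝ → Config N := fun s => update X i (X i + s • (X j - X i)) with hP
  have hPc : Continuous P := continuous_const.update i (by fun_prop)
  have hP0 : P 0 = X := by simp [P]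
  have htend : Tendsto P (𝓝[>] 0) (𝓝 X) :=
    (hP0 ▸ hPc.continuousAt.tendsto).mono_left nhdsWithin_le_nhds
  refine mem_closure_of_tendsto htend ?_
  filter_upwards [Ioo_mem_nhdsGT one_pos] with s hs
  refine ⟨i, j, hij, ?_⟩
  have hi : P s i = X i + s • (X j - X i) := by simp [P]
  have hj : P s j = X j := by simp [P, hij.symm]
  rw [hi, hj, dist_eq_norm,
    show X i + s • (X j - X i) - X j = (1 - s) • (X i - X j) by module, norm_smul,
    Real.norm_eq_abs, abs_of_pos (by linarith [hs.2]), ← dist_eq_norm]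
  calc (1 - s) * dist (X i) (X j) ≤ (1 - s) * a :=
        mul_le_mul_of_nonneg_left h (by linarith [hs.2])
    _ < a := by nlinarith [hs.1]

/-- **Finite energy keeps hard cores apart**: if `v = +∞` below distance `a` and the energy of the
continuous wave function `ψ` is finite, then `ψ` vanishes on every configuration with overlapping
cores (the integrand is `+∞` on the open set where `ψ ≠ 0` and two cores overlap, which must
therefore be empty). [cite: LSSY2005, Ch. 2, paragraph after eq. (2.1)] -/
theorem eq_zero_of_mem_coreSet (hcore : ∀ r, r < a → v r = ⊤) {ψ : Config N → ℂ}
    (hψc : Continuous ψ) (hE : rawEnergy v ψ ≠ ⊤) {X : Config N} (hX : X ∈ coreSet a N) :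
    ψ X = 0 := by
  by_contra hne
  set W : Set (Config N) := coreSet a N ∩ {Y | ψ Y ≠ 0} with hW
  have hWo : IsOpen W := isOpen_coreSet.inter (isOpen_ne_fun hψc continuous_const)
  have hWpos : 0 < volume W := hWo.measure_pos volume ⟨X, hX, hne⟩
  have htop : ∀ Y ∈ W, kineticDensity ψ Y + interaction v Y * (‖ψ Y‖₊ : ℝ≥0∞) ^ 2 = ⊤ := by
    rintro Y ⟨⟨i, j, hij, hd⟩, hY⟩
    have hne0 : (‖ψ Y‖₊ : ℝ≥0∞) ^ 2 ≠ 0 := by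
      simpa using hY
    rw [interaction_eq_top_of_apply_eq_top hij (hcore _ hd), ENNReal.top_mul hne0, add_top]
  apply hE
  refine eq_top_iff.2 ?_
  calc (⊤ : ℝ≥0∞) = ∫⁻ _ in W, ⊤ := by rw [setLIntegral_const, ENNReal.top_mul hWpos.ne']
    _ ≤ ∫⁻ Y in W, kineticDensity ψ Y + interaction v Y * (‖ψ Y‖₊ : ℝ≥0∞) ^ 2 :=
        setLIntegral_mono' hWo.measurableSet fun Y hY => (htop Y hY).ge
    _ ≤ rawEnergy v ψ := setLIntegral_le_lintegral _ _

/-- Hence `ψ` vanishes at contact too (`|x_i - x_j| ≤ a`), by continuity. [folklore] -/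
theorem eq_zero_of_dist_le (ha : 0 < a) (hcore : ∀ r, r < a → v r = ⊤) {ψ : Config N → ℂ}
    (hψc : Continuous ψ) (hE : rawEnergy v ψ ≠ ⊤) (X : Config N) (i j : Fin N) (hij : i ≠ j)
    (h : dist (X i) (X j) ≤ a) : ψ X = 0 :=
  (isClosed_eq hψc continuous_const).closure_subset_iff.2
    (fun _ hY => eq_zero_of_mem_coreSet hcore hψc hE hY) (mem_closure_coreSet ha hij h)

/-- … and so does its gradient. [folklore] -/
theorem fderiv_eq_zero_of_dist_le (ha : 0 < a) (hcore : ∀ r, r < a → v r = ⊤)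
    {ψ : Config N → ℂ} (hψ : ContDiff ℝ 1 ψ) (hE : rawEnergy v ψ ≠ ⊤) {X : Config N}
    {i j : Fin N} (hij : i ≠ j) (h : dist (X i) (X j) ≤ a) : fderiv ℝ ψ X = 0 :=
  fderiv_eq_zero_of_mem_closure hψ isOpen_coreSet
    (fun _ hY => eq_zero_of_mem_coreSet hcore hψ.continuous hE hY) (mem_closure_coreSet ha hij h)

/-- **Neighbour count by volume.** If all particles are pairwise at distance `≥ a`, at most `64`
of them are within `3a/2` of a given one: the balls of radius `a/2` around them are disjoint and
lie in the ball of radius `2a`. [folklore] -/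
theorem card_filter_dist_lt_le (ha : 0 < a) {X : Config N}
    (hsep : ∀ j j' : Fin N, j ≠ j' → a ≤ dist (X j) (X j')) (i : Fin N) :
    (Finset.univ.filter fun j => j ≠ i ∧ dist (X i) (X j) < 3 * a / 2).card ≤ 64 := by
  set J := Finset.univ.filter fun j => j ≠ i ∧ dist (X i) (X j) < 3 * a / 2 with hJ
  have hdisj : (J : Set (Fin N)).PairwiseDisjoint fun j => Metric.ball (X j) (a / 2) := by
    intro j _ j' _ hjj'
    exact Metric.ball_disjoint_ball (by rw [add_halves]; exact hsep j j' hjj')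
  have hsub : (⋃ j ∈ J, Metric.ball (X j) (a / 2)) ⊆ Metric.ball (X i) (2 * a) := by
    intro x hx
    simp only [mem_iUnion] at hx
    obtain ⟨j, hj, hx⟩ := hx
    have hj' := (Finset.mem_filter.1 hj).2.2
    rw [Metric.mem_ball] at hx ⊢
    calc dist x (X i) ≤ dist x (X j) + dist (X j) (X i) := dist_triangle _ _ _
      _ < a / 2 + 3 * a / 2 := add_lt_add hx (by rwa [dist_comm])
      _ = 2 * a := by ring
  have hvol := measure_mono (μ := volume) hsub
  rw [measure_biUnion_finset hdisj (fun j _ => measurableSet_ball)] at hvol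
  simp only [Measure.addHaar_ball volume _ (by positivity : (0:ℝ) ≤ a / 2), Finset.sum_const,
    nsmul_eq_mul, finrank_euclideanSpace_fin] at hvol
  rw [Measure.addHaar_ball volume _ (by positivity : (0:ℝ) ≤ 2 * a),
    finrank_euclideanSpace_fin] at hvol
  have hV0 : volume (Metric.ball (0 : Space) 1) ≠ 0 := (Metric.measure_ball_pos volume _ one_pos).ne'
  have hVt : volume (Metric.ball (0 : Space) 1) ≠ ⊤ := measure_ball_lt_top.ne
  have h2 : ENNReal.ofReal ((2 * a) ^ 3) = 64 * ENNReal.ofReal ((a / 2) ^ 3) := by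
    rw [show (2 * a) ^ 3 = 64 * (a / 2) ^ 3 by ring, ENNReal.ofReal_mul (by norm_num)]
    norm_num
  rw [h2, mul_assoc (64 : ℝ≥0∞)] at hvol
  have hc0 : ENNReal.ofReal ((a / 2) ^ 3) * volume (Metric.ball (0 : Space) 1) ≠ 0 :=
    mul_ne_zero (by positivity) hV0
  have hct : ENNReal.ofReal ((a / 2) ^ 3) * volume (Metric.ball (0 : Space) 1) ≠ ⊤ :=
    ENNReal.mul_ne_top ENNReal.ofReal_ne_top hVt
  have h3 : ((J.card : ℕ) : ℝ≥0∞) ≤ 64 := (ENNReal.mul_le_mul_iff_left hc0 hct).1 hvol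
  exact_mod_cast h3

end Core

/-! ### The shell estimate on configuration space and the tight-pair bound -/

section Assembly

variable {N : ℕ} {a δ : ℝ} {v : ℝ → ℝ≥0∞}

/-- `X ↦ |∂_u ψ(X)|²` is measurable for `C¹` `ψ`. [folklore] -/
theorem measurable_ennnormSq_fderiv_apply {ψ : Config N → ℂ} (hψ : ContDiff ℝ 1 ψ)
    (u : Config N) : Measurable fun X => (‖fderiv ℝ ψ X u‖₊ : ℝ≥0∞) ^ 2 :=
  (((hψ.continuous_fderiv one_ne_zero).clm_apply continuous_const).measurable.nnnorm
    |>.coe_nnreal_ennreal).pow_const 2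

/-- The coordinate line is continuous in its parameter. [folklore] -/
theorem continuous_linePoint (X : Config N) (i : Fin N) (y : Fin 3 → ℝ) (k : Fin 3) :
    Continuous (linePoint X i y k) := by
  rw [show linePoint X i y k = fun t => linePoint X i y k 0 + t • unitVec i k from
    funext (linePoint_eq_add_smul X i y k)]
  fun_prop

/-- The shell estimate for one pair and one cone, on configuration space (Fubini over the lines
parallel to `e_{i,k}`). [folklore] -/
theorem lintegral_shellPairCone_le (ha : 0 < a) (hδ : 0 < δ) (hδa : δ ≤ a)
    {ψ : Config N → ℂ} (hψ : ContDiff ℝ 1 ψ)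
    (hzero : ∀ X : Config N, ∀ i j : Fin N, i ≠ j → dist (X i) (X j) ≤ a → ψ X = 0)
    {i j : Fin N} (hij : i ≠ j) (k : Fin 3) {σ : ℝ} (hσ : σ = 1 ∨ σ = -1) :
    ∫⁻ X, (shellPairCone a δ i j k σ).indicator (fun X => (‖ψ X‖₊ : ℝ≥0∞) ^ 2) X ≤
      ENNReal.ofReal (9 * δ ^ 2) * ∫⁻ X, (shellPairSign a δ i j k σ).indicator
          (fun X => (‖fderiv ℝ ψ X (unitVec i k)‖₊ : ℝ≥0∞) ^ 2) X := by
  have hF : Measurable fun X => (shellPairCone a δ i j k σ).indicator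
      (fun X => (‖ψ X‖₊ : ℝ≥0∞) ^ 2) X :=
    (measurable_ennnormSq hψ.continuous).indicator (measurableSet_shellPairCone a δ i j k σ)
  have hG : Measurable fun X => (shellPairSign a δ i j k σ).indicator
      (fun X => (‖fderiv ℝ ψ X (unitVec i k)‖₊ : ℝ≥0∞) ^ 2) X :=
    (measurable_ennnormSq_fderiv_apply hψ _).indicator (measurableSet_shellPairSign a δ i j k σ)
  rw [← lintegral_const_mul _ hG]
  refine lintegral_le_of_forall_line i k hF (measurable_const.mul hG) fun X y => ?_
  rw [lintegral_const_mul _ (show Measurable (fun t => (shellPairSign a δ i j k σ).indicator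
      (fun X => (‖fderiv ℝ ψ X (unitVec i k)‖₊ : ℝ≥0∞) ^ 2) (linePoint X i y k t)) from
    hG.comp (continuous_linePoint X i y k).measurable)]
  exact lintegral_line_shellPairCone_le ha hδ hδa hψ hzero hij k hσ X y

/-- **The shell estimate for one pair**: the mass of `ψ` on `a < |x_i - x_j| < a + δ` is at most
`9δ²` times the `∇_i`-energy on the same shell (`δ ≤ a/20`). [folklore] -/
theorem lintegral_shellPair_le (ha : 0 < a) (hδ : 0 < δ) (hδa : 20 * δ ≤ a)
    {ψ : Config N → ℂ} (hψ : ContDiff ℝ 1 ψ)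
    (hzero : ∀ X : Config N, ∀ i j : Fin N, i ≠ j → dist (X i) (X j) ≤ a → ψ X = 0)
    {i j : Fin N} (hij : i ≠ j) :
    ∫⁻ X, (shellPair a δ i j).indicator (fun X => (‖ψ X‖₊ : ℝ≥0∞) ^ 2) X ≤
      ENNReal.ofReal (9 * δ ^ 2) * ∫⁻ X, (shellPair a δ i j).indicator
          (fun X => ∑ k : Fin 3, (‖fderiv ℝ ψ X (unitVec i k)‖₊ : ℝ≥0∞) ^ 2) X := by
  have hδa' : δ ≤ a := by linarith
  set f := fun X : Config N => (‖ψ X‖₊ : ℝ≥0∞) ^ 2 with hf_def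
  set g := fun (k : Fin 3) (X : Config N) => (‖fderiv ℝ ψ X (unitVec i k)‖₊ : ℝ≥0∞) ^ 2
    with hg_def
  have hf : Measurable f := measurable_ennnormSq hψ.continuous
  have hg : ∀ k, Measurable (g k) := fun k => measurable_ennnormSq_fderiv_apply hψ _
  have hmc : ∀ k σ, Measurable fun X => (shellPairCone a δ i j k σ).indicator f X :=
    fun k σ => hf.indicator (measurableSet_shellPairCone a δ i j k σ)
  have hms : ∀ k σ, Measurable fun X => (shellPairSign a δ i j k σ).indicator (g k) X :=
    fun k σ => (hg k).indicator (measurableSet_shellPairSign a δ i j k σ)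
  calc ∫⁻ X, (shellPair a δ i j).indicator f X
      ≤ ∫⁻ X, ∑ k : Fin 3, ((shellPairCone a δ i j k 1).indicator f X +
          (shellPairCone a δ i j k (-1)).indicator f X) :=
        lintegral_mono fun X => indicator_shellPair_le_sum ha hδa i j f X
    _ = ∑ k : Fin 3, ((∫⁻ X, (shellPairCone a δ i j k 1).indicator f X) +
          ∫⁻ X, (shellPairCone a δ i j k (-1)).indicator f X) := by
        rw [lintegral_finsetSum _ fun k _ =>
          show Measurable (fun X => (shellPairCone a δ i j k 1).indicator f X +
            (shellPairCone a δ i j k (-1)).indicator f X) from (hmc k 1).add (hmc k (-1))]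
        exact Finset.sum_congr rfl fun k _ => lintegral_add_left (hmc k 1) _
    _ ≤ ∑ k : Fin 3, (ENNReal.ofReal (9 * δ ^ 2) *
          (∫⁻ X, (shellPairSign a δ i j k 1).indicator (g k) X) +
          ENNReal.ofReal (9 * δ ^ 2) *
            ∫⁻ X, (shellPairSign a δ i j k (-1)).indicator (g k) X) :=
        Finset.sum_le_sum fun k _ => add_le_add
          (lintegral_shellPairCone_le ha hδ hδa' hψ hzero hij k (Or.inl rfl))
          (lintegral_shellPairCone_le ha hδ hδa' hψ hzero hij k (Or.inr rfl))
    _ = ENNReal.ofReal (9 * δ ^ 2) * ∫⁻ X, ∑ k : Fin 3,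
          ((shellPairSign a δ i j k 1).indicator (g k) X +
            (shellPairSign a δ i j k (-1)).indicator (g k) X) := by
        rw [lintegral_finsetSum _ fun k _ =>
          show Measurable (fun X => (shellPairSign a δ i j k 1).indicator (g k) X +
            (shellPairSign a δ i j k (-1)).indicator (g k) X) from (hms k 1).add (hms k (-1)),
          Finset.mul_sum]
        refine Finset.sum_congr rfl fun k _ => ?_
        rw [lintegral_add_left (hms k 1), mul_add]
    _ ≤ ENNReal.ofReal (9 * δ ^ 2) * ∫⁻ X, (shellPair a δ i j).indicator
          (fun X => ∑ k : Fin 3, g k X) X := by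
        refine mul_le_mul' le_rfl (lintegral_mono fun X => ?_)
        by_cases hX : X ∈ shellPair a δ i j
        · rw [indicator_of_mem hX]
          refine Finset.sum_le_sum fun k _ => ?_
          have := indicator_shellPairSign_add_le (a := a) (δ := δ) i j k (g k) X
          rwa [indicator_of_mem hX] at this
        · have h1 : ∀ k σ, X ∉ shellPairSign a δ i j k σ := fun k σ h => hX h.1
          simp [indicator_of_notMem hX, indicator_of_notMem (h1 _ _)]

/-- **Few tight pairs at finite energy (hard cores).** For a `C¹` wave function of finite energy
for a potential with hard core of diameter `a`, the expected number of ordered pairs within `δ`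
of contact is at most `576 δ²` times the kinetic energy (`δ ≤ a/20`):
`∑_i ∑_{j≠i} ∫ 1{a < |x_i-x_j| < a+δ} |ψ|² ≤ 576 δ² ∫ |∇ψ|²`. (Shell Poincaré along coordinate
lines; each particle has at most 64 neighbours within `3a/2` by volume.) [folklore] -/
theorem sum_lintegral_shellPair_le (ha : 0 < a) (hδ : 0 < δ) (hδa : 20 * δ ≤ a)
    (hcore : ∀ r, r < a → v r = ⊤) {ψ : Config N → ℂ} (hψ : ContDiff ℝ 1 ψ)
    (hE : rawEnergy v ψ ≠ ⊤) :
    ∑ i : Fin N, ∑ j ∈ Finset.univ.erase i,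
        ∫⁻ X, (shellPair a δ i j).indicator (fun X => (‖ψ X‖₊ : ℝ≥0∞) ^ 2) X ≤
      ENNReal.ofReal (576 * δ ^ 2) * ∫⁻ X, kineticDensity ψ X := by
  classical
  have hzero : ∀ X : Config N, ∀ i j : Fin N, i ≠ j → dist (X i) (X j) ≤ a → ψ X = 0 :=
    eq_zero_of_dist_le ha hcore hψ.continuous hE
  set g := fun (i : Fin N) (k : Fin 3) (X : Config N) =>
    (‖fderiv ℝ ψ X (unitVec i k)‖₊ : ℝ≥0∞) ^ 2 with hg_def
  have hg : ∀ i k, Measurable (g i k) := fun i k => measurable_ennnormSq_fderiv_apply hψ _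
  have hgs : ∀ i, Measurable fun X => ∑ k : Fin 3, g i k X := fun i =>
    Finset.measurable_sum _ fun k _ => hg i k
  -- pointwise neighbour bound where the gradient does not vanish
  have hcount : ∀ (X : Config N) (i : Fin N),
      (∑ j ∈ Finset.univ.erase i, (shellPair a δ i j).indicator (fun X => ∑ k : Fin 3, g i k X) X) ≤
        64 * ∑ k : Fin 3, g i k X := by
    intro X i
    by_cases hD : fderiv ℝ ψ X = 0
    · have h0 : ∀ k, g i k X = 0 := fun k => by simp [g, hD]
      simp [h0]
    · have hsep : ∀ j j' : Fin N, j ≠ j' → a ≤ dist (X j) (X j') := by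
        intro j j' hjj'
        by_contra hlt
        exact hD (fderiv_eq_zero_of_dist_le ha hcore hψ hE hjj' (not_le.1 hlt).le)
      calc (∑ j ∈ Finset.univ.erase i, (shellPair a δ i j).indicator (fun X => ∑ k, g i k X) X)
          ≤ ∑ j ∈ Finset.univ.filter (fun j => j ≠ i ∧ dist (X i) (X j) < 3 * a / 2),
              ∑ k, g i k X := by
            rw [← Finset.sum_filter_add_sum_filter_not (Finset.univ.erase i)
              (fun j => X ∈ shellPair a δ i j)]
            have hz : ∑ j ∈ (Finset.univ.erase i).filter (fun j => X ∉ shellPair a δ i j),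
                (shellPair a δ i j).indicator (fun X => ∑ k, g i k X) X = 0 :=
              Finset.sum_eq_zero fun j hj => indicator_of_notMem (Finset.mem_filter.1 hj).2 _
            rw [hz, add_zero]
            refine (Finset.sum_congr rfl fun j hj => indicator_of_mem (Finset.mem_filter.1 hj).2 _).le.trans ?_
            refine Finset.sum_le_sum_of_subset_of_nonneg (fun j hj => ?_) fun _ _ _ => zero_le
            simp only [Finset.mem_filter, Finset.mem_erase, Finset.mem_univ, true_and,
              and_true] at hj ⊢
            exact ⟨hj.1, hj.2.2.trans_le (by linarith)⟩
        _ ≤ 64 * ∑ k, g i k X := by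
            rw [Finset.sum_const, nsmul_eq_mul]
            exact mul_le_mul' (by exact_mod_cast card_filter_dist_lt_le ha hsep i) le_rfl
  calc ∑ i : Fin N, ∑ j ∈ Finset.univ.erase i,
        ∫⁻ X, (shellPair a δ i j).indicator (fun X => (‖ψ X‖₊ : ℝ≥0∞) ^ 2) X
      ≤ ∑ i : Fin N, ∑ j ∈ Finset.univ.erase i, ENNReal.ofReal (9 * δ ^ 2) *
          ∫⁻ X, (shellPair a δ i j).indicator (fun X => ∑ k : Fin 3, g i k X) X :=
        Finset.sum_le_sum fun i _ => Finset.sum_le_sum fun j hj =>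
          lintegral_shellPair_le ha hδ hδa hψ hzero (Finset.ne_of_mem_erase hj).symm
    _ = ENNReal.ofReal (9 * δ ^ 2) * ∫⁻ X, ∑ i : Fin N, ∑ j ∈ Finset.univ.erase i,
          (shellPair a δ i j).indicator (fun X => ∑ k : Fin 3, g i k X) X := by
        rw [lintegral_finsetSum _ fun i _ =>
          show Measurable (fun X => ∑ j ∈ Finset.univ.erase i,
            (shellPair a δ i j).indicator (fun X => ∑ k : Fin 3, g i k X) X) from
            Finset.measurable_sum _ fun j _ => (hgs i).indicator (measurableSet_shellPair a δ i j),
          Finset.mul_sum]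
        refine Finset.sum_congr rfl fun i _ => ?_
        rw [lintegral_finsetSum _ fun j _ =>
          show Measurable (fun X => (shellPair a δ i j).indicator (fun X => ∑ k : Fin 3, g i k X) X)
            from (hgs i).indicator (measurableSet_shellPair a δ i j), Finset.mul_sum]
    _ ≤ ENNReal.ofReal (9 * δ ^ 2) * ∫⁻ X, ∑ i : Fin N, 64 * ∑ k : Fin 3, g i k X :=
        mul_le_mul' le_rfl (lintegral_mono fun X => Finset.sum_le_sum fun i _ => hcount X i)
    _ = ENNReal.ofReal (9 * δ ^ 2) * (64 * ∫⁻ X, kineticDensity ψ X) := by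
        rw [← lintegral_const_mul _ (measurable_kineticDensity_any ψ)]
        congr 1
        refine lintegral_congr fun X => ?_
        rw [← Finset.mul_sum]
        rfl
    _ = ENNReal.ofReal (576 * δ ^ 2) * ∫⁻ X, kineticDensity ψ X := by
        rw [← mul_assoc]
        congr 1
        rw [← ENNReal.ofReal_ofNat 64, ← ENNReal.ofReal_mul (by positivity)]
        congr 1
        norm_num
        ring

end Assembly

end Literature.MathematicalPhysics.QuantumManyBody.BoseGas

end
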